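import Mathlib
import Summits.NavierStokesRegularity.FluidComputer.AbcInertiaExactlyOneTightR500
import Summits.NavierStokesRegularity.FluidComputer.AbcInertiaCIExactlyPairR500

/-!
# THE LEADER AT `R = 500` AS ONE KERNEL SENTENCE: the class-II steady mode of the linearisation about the forced
# ABC flow lies STRICTLY TO THE RIGHT of the whole class-I point spectrum — with `AbcContestIR300` (class I leads
# at R 300) this is the LEADER FLIP I → II between R 300 and R 500 (instab3 g9, cell `ns-blowup`, 2026-08-27)

HONEST FRAMING (human rulings D-0035/D-0074): **MODEL linear operator, computer-assisted; not NS.** Nothing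
here is a statement about Navier–Stokes regularity or blow-up. Object: the linearisation of forced NS about
`U = abcFlow 1 1 1` on the unit torus at viscosity `1/(2π·500)` (`R = 500` in certifier units), symmetry
classes I and II SEPARATELY; classes III–V are NOT treated (CLASS-TABLE float: III–V trail at R 500; instab4 K3
is the symmetry-free programme, R 300 only). bears_on LADDER-NS N1* T6 («which mode leads the forced ABC flow;
does the class ordering flip with Re?» — director-ns l.462) / profile W3. WHAT THIS IS NOT: not NS; no
certificate re-run; no number or census word moves; a kernel IMPLICATION whose hypotheses are the finite-matrix
facts three certificates print.

THE SENTENCE (`contestI_R500_i4`; the R 500 INERTIA cells exist in implementation 2 only — instab4 g8, kit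
j274542/j274818, refuter2 custody K-READ STATUS 2026-08-27T12:00Z): GIVEN (T1) the row `Row5002C` (class II) and
(T2) the row `Row5001C` (class I) of profile-cert-3 in their classical-eigenpair forms (cert-3 g9), and the
INERTIA-3L cells `(500, II, 6/25, 1; 36, 37)`, `(500, I, 1/4, 2; 36, 37)` — THEN: `σ_p(L_500|II) ∩ {Re ≥ 6/25}
= {λ_II}`, `λ_II` REAL, `|λ_II − 0.2901820370561| ≤ 5.4·10⁻⁹`; `σ_p(L_500|I) ∩ {Re ≥ 1/4} = {λ_I, conj λ_I}`,
`|λ_I − (0.2853678022285 + 0.645286271133 i)| ≤ 5.9·10⁻⁹`, `Im λ_I > 0`; `Re λ_I < λ_II`; and **`Re z < Re λ_II`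
for EVERY classical class-I eigenpair `(z, u)`** (`γ_II(500) − γ_I(500) ≥ 0.0048142 > 0`). With
`AbcContestIR300.contestI_R300_i3/_i4` («`Re z < Re λ_I(300)` for every classical class-II eigenpair»): the
nominal leader of the MODEL operator (classes I/II) FLIPS from the class-I Hopf pair (R 300) to the class-II
steady mode (R 500) — CLASS-TABLE v2's float crossover `R_× ≈ 360` bracketed by two kernel sentences. (For the
leading statement itself the class-II INERTIA cell is not needed — only Row5002C's existence; it is carried for
the «exactly one / λ_II real and simple-in-count» clause.)

* `lead_of_exactly_pair` (§1, generic): «exactly the pair right of `a`» (class I) + `a ≤ ℓ_I − ρ_I` +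
  `ℓ_I + ρ_I < ℓ_II − ρ_II ≤ Re λ_II` ⇒ every classical class-I eigenpair has `Re z < Re λ_II`.
* `row5001C_add_rho_lt_row5002C_sub_rho`, `lead_margin_R500` (`≥ 0.0048142`): `norm_num` on the tree literals.

What is NOT kernel (referee list): the rows' primary interval outputs and (R1)(R2) ×2 = the programs' verified
arithmetic (R 500 INERTIA: single implementation), AUDIT-BASIS (class-II INERTIA: any real orthonormal orbit bases
`e`; class-I INERTIA: the tree's bases `AbcClassI.bfam`; rows: any admissible complex orbit bases), classes III–V.

Mathlib + the two files named; no new definitions; std axioms. [folklore]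
-/

noncomputable section

open scoped BigOperators ComplexConjugate InnerProductSpace Matrix
open Finset Matrix MeasureTheory UnitAddTorus

namespace Summit.NavierStokesRegularity.FluidComputer.AbcContestI

open Literature.Analysis.FunctionSpaces Literature.Analysis.FunctionSpaces.Torus
open Literature.Analysis.FunctionSpaces.EuclideanSpace
open Literature.Analysis.FluidPDE Literature.Analysis.FluidPDE.SteadyLattice
open Summit.NavierStokesRegularity.FluidComputer.AbcClassII
open Summit.NavierStokesRegularity.FluidComputer.AbcClassI (IsClassI)
open Summit.NavierStokesRegularity.FluidComputer.CertificateAbcSpectrum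

/-! ### §1 The generic comparison and the numeric order of the two enclosures -/

/-- **Exactly-the-pair (class I) + the class-II abscissa ⇒ the class-II mode leads.** If every classical class-I
eigenvalue with `Re z ≥ a` is `λ_I` or `conj λ_I`, `|λ_I − λ̃_I| ≤ ρ_I` with `Re λ̃_I = ℓ_I`, `a ≤ ℓ_I − ρ_I`, and
`ℓ_I + ρ_I < ℓ_II − ρ_II ≤ Re λ_II`, then EVERY classical class-I eigenpair `(z, u)` has `Re z < Re λ_II`. -/
theorem lead_of_exactly_pair {ν a ℓI ρI ℓII ρII : ℝ} {ltI : ℂ} (hlt : ltI.re = ℓI) (hord : ℓI + ρI < ℓII - ρII)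
    (ha : a ≤ ℓI - ρI) (lamI : ℂ) (hclose : ‖lamI - ltI‖ ≤ ρI)
    (huniq : ∀ (z : ℂ) (u : UnitAddTorus (Fin 3) → EuclideanSpace ℂ (Fin 3)),
      Torus.LinNSResolventRel ν (Torus.abcFlow 1 1 1) (2 * Real.pi * z) u 0 → u ≠ 0 →
        IsClassI (mFourierCoeff u) → a ≤ z.re → z = lamI ∨ z = conj lamI)
    (lamII : ℂ) (hreloII : ℓII - ρII ≤ lamII.re) :
    ∀ (z : ℂ) (u : UnitAddTorus (Fin 3) → EuclideanSpace ℂ (Fin 3)),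
      Torus.LinNSResolventRel ν (Torus.abcFlow 1 1 1) (2 * Real.pi * z) u 0 → u ≠ 0 →
        IsClassI (mFourierCoeff u) → z.re < lamII.re := by
  intro z u hu hu0 huI
  have hρ : 0 ≤ ρI := (norm_nonneg _).trans hclose
  have hI : lamI.re ≤ ℓI + ρI := by
    have h1 : |(lamI - ltI).re| ≤ ‖lamI - ltI‖ := Complex.abs_re_le_norm _
    rw [Complex.sub_re, hlt] at h1
    have h3 := (abs_le.mp (h1.trans hclose)).2
    linarith
  by_cases hz : a ≤ z.re
  · rcases huniq z u hu hu0 huI hz with h | h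
    · subst h; linarith
    · subst h; rw [Complex.conj_re]; linarith
  · push Not at hz
    linarith

/-- The two enclosures of record at `R = 500` are ORDERED the other way than at `R = 300`:
`Row5001C.lamRe + Row5001C.rho < Row5002C.lamRe − Row5002C.rho` (`0.28536… + 5.9·10⁻⁹ < 0.29018… − 5.4·10⁻⁹`). -/
theorem row5001C_add_rho_lt_row5002C_sub_rho :
    ((Row5001C.lamRe : ℚ) : ℝ) + ((Row5001C.rho : ℚ) : ℝ) < ((Row5002C.lamRe : ℚ) : ℝ) - ((Row5002C.rho : ℚ) : ℝ) := by
  have h : Row5001C.lamRe + Row5001C.rho < Row5002C.lamRe - Row5002C.rho := by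
    norm_num [Row5002C.lamRe, Row5002C.rho, Row5001C.lamRe, Row5001C.rho]
  have h' : ((Row5001C.lamRe + Row5001C.rho : ℚ) : ℝ) < ((Row5002C.lamRe - Row5002C.rho : ℚ) : ℝ) := by
    exact_mod_cast h
  push_cast at h'
  linarith

/-- The leader margin of record at `R = 500`: `Row5002C.lamRe − Row5002C.rho − (Row5001C.lamRe + Row5001C.rho) ≥ 0.0048142`. -/
theorem lead_margin_R500 :
    (48142 / 10000000 : ℝ) ≤ ((Row5002C.lamRe : ℚ) : ℝ) - ((Row5002C.rho : ℚ) : ℝ) -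
      (((Row5001C.lamRe : ℚ) : ℝ) + ((Row5001C.rho : ℚ) : ℝ)) := by
  have h : (48142 / 10000000 : ℚ) ≤ Row5002C.lamRe - Row5002C.rho - (Row5001C.lamRe + Row5001C.rho) := by
    norm_num [Row5002C.lamRe, Row5002C.rho, Row5001C.lamRe, Row5001C.rho]
  have h' : ((48142 / 10000000 : ℚ) : ℝ) ≤
      ((Row5002C.lamRe - Row5002C.rho - (Row5001C.lamRe + Row5001C.rho) : ℚ) : ℝ) := by exact_mod_cast h
  push_cast at h'
  linarith

/-! ### §2 The END-TO-END sentence (R 500, classes II vs I) -/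

section Rows

variable (wf : Idx → Fam)
variable (hws : ∀ i : Idx, ∀ k ∉ i.1.1, wf i k = 0)
variable (hwt : ∀ (i : Idx) (k : Fin 3 → ℤ), ∑ j : Fin 3, ((k j : ℤ) : ℂ) * wf i k j = 0)
variable (hwII : ∀ i : Idx, IsClassII (wf i))
variable (hwon : ∀ (O : Orbit) (a b : Fin (odim O)),
  ∑ k ∈ O.1, (inner ℂ (wf ⟨O, a⟩ k) (wf ⟨O, b⟩ k) : ℂ) = if a = b then 1 else 0)
variable (amc : Idx → Idx → ℂ)
variable (hamc : ∀ i j : Idx, amc i j =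
  ∑ k ∈ i.1.1, (inner ℂ (wf i k) (Torus.lerayCoeff k (crossForm 1 1 1 (wf j) k)) : ℂ))
variable (e : ∀ O : Orbit, OrthonormalBasis (Fin (odim O)) ℝ (realSpace O.1))
variable (bf : Idx → Fam)
variable (hbf : ∀ i : Idx, bf i = extend i.1.1 ((e i.1 i.2 : realSpace i.1.1) : EuclideanSpace ℂ (↥i.1.1 × Fin 3)))
variable (am : Idx → Idx → ℝ)
variable (ham : ∀ i j : Idx, am i j =
  (∑ k ∈ i.1.1, (inner ℂ (bf i k) (Torus.lerayCoeff k (crossForm 1 1 1 (bf j) k)) : ℂ)).re)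
variable (wfI : AbcClassI.Idx → Fam)
variable (hwsI : ∀ i : AbcClassI.Idx, ∀ k ∉ i.1.1, wfI i k = 0)
variable (hwtI : ∀ (i : AbcClassI.Idx) (k : Fin 3 → ℤ), ∑ j : Fin 3, ((k j : ℤ) : ℂ) * wfI i k j = 0)
variable (hwI : ∀ i : AbcClassI.Idx, IsClassI (wfI i))
variable (hwonI : ∀ (O : Orbit) (a b : Fin (AbcClassI.odim O)),
  ∑ k ∈ O.1, (inner ℂ (wfI ⟨O, a⟩ k) (wfI ⟨O, b⟩ k) : ℂ) = if a = b then 1 else 0)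
variable (amcI : AbcClassI.Idx → AbcClassI.Idx → ℂ)
variable (hamcI : ∀ i j : AbcClassI.Idx, amcI i j =
  ∑ k ∈ i.1.1, (inner ℂ (wfI i k) (Torus.lerayCoeff k (crossForm 1 1 1 (wfI j) k)) : ℂ))

include hws hwt hwII hwon hamc hbf ham hwsI hwtI hwI hwonI hamcI in
/-- **THE LEADER AT R = 500 AS ONE KERNEL SENTENCE — IMPLEMENTATION 2's INERTIA cells (class II (36, 37),
class I (36, 37); kit j274542/j274818).** HYPOTHESES (three/four script-certified finite-matrix fact families, each
VERBATIM as in the file that consumes it): the T1 row `Row5002C` (class II, complex orbit bases `wf`); the INERTIA-3L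
class-II cell `(500, II, 6/25, 1; 36, 37)` in the real orthonormal orbit bases `e`
(`AbcInertiaExactlyOneTightR500.R500II_exactly_one_tight_i4`); the T2 row `Row5001C` (class I, complex orbit bases
`wfI`); the INERTIA-3L class-I cell `(500, I, 1/4, 2; 36, 37)` on `AbcClassI.amat`
(`AbcInertiaCIExactlyPairR500.R500I_exactly_pair_i4`). CONCLUSION: the class-II leader `λ_II` (REAL, a classical
class-II eigenfunction, ALL of `σ_p(L|II) ∩ {Re ≥ 6/25}`), the class-I Hopf pair `λ_I, conj λ_I` (ALL of
`σ_p(L|I) ∩ {Re ≥ 1/4}`), `Re λ_I < λ_II`, and **every classical class-I eigenpair `(z, u)` has `Re z < Re λ_II`**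
— at R 500 the class-II steady mode LEADS the whole class-I point spectrum. MODEL; conditional on the certifier
audits and AUDIT-BASIS; classes III–V untreated. -/
theorem contestI_R500_i4
    (vt : Idx → ℂ) (hvt0 : ∀ i, i ∉ cubeIdx 112 → vt i = 0)
    (hres : ∑ i ∈ cubeIdx 112 ∪ (cubeIdx 112).biUnion nbrIdx,
      ‖(if i ∈ cubeIdx 112 then ((((Row5002C.lamRe : ℚ) : ℝ) : ℂ) - ((-(onormSq i.1 / 500) : ℝ) : ℂ)) * vt i
          else 0) - ∑ j ∈ cubeIdx 112, amc i j * vt j‖ ^ 2 ≤ ((Row5002C.rnorm : ℚ) : ℝ) ^ 2)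
    (hntb : ∑ i ∈ cubeIdx 112 \ cubeIdx 28, ‖vt i‖ ^ 2 ≤
      (((1292560462104437 : ℚ) / 144115188075855872 : ℚ) : ℝ) ^ 2)
    (Binv : ((↥(cubeIdx 28) → ℂ) × ℂ) →ₗ[ℂ] ((↥(cubeIdx 28) → ℂ) × ℂ))
    (hBinv : ∀ (c : ↥(cubeIdx 28) → ℂ) (m : ℂ),
      Binv (fun i : ↥(cubeIdx 28) =>
          ((((Row5002C.lamRe : ℚ) : ℝ) : ℂ) - ((-(onormSq i.1.1 / 500) : ℝ) : ℂ)) * c i -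
          ∑ j : ↥(cubeIdx 28), amc i j * c j + m * vt i,
        ∑ i : ↥(cubeIdx 28), conj (vt i) * c i) = (c, m))
    (hαM : ∀ (c : ↥(cubeIdx 28) → ℂ) (g : ℂ),
      ∑ j : ↥(cubeIdx 28), ‖(Binv (c, g)).1 j‖ ^ 2 + ‖(Binv (c, g)).2‖ ^ 2 ≤
        ((Row5002C.alpha0 : ℚ) : ℝ) ^ 2 * (∑ i : ↥(cubeIdx 28), ‖c i‖ ^ 2 + ‖g‖ ^ 2))
    (hβBM : ∀ w : Idx → ℂ,
      ∑ j : ↥(cubeIdx 28), ‖(Binv (fun i : ↥(cubeIdx 28) => -∑ j ∈ nbrIdx i \ cubeIdx 28,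
          amc i j * w j, 0)).1 j‖ ^ 2 +
        ‖(Binv (fun i : ↥(cubeIdx 28) => -∑ j ∈ nbrIdx i \ cubeIdx 28,
          amc i j * w j, 0)).2‖ ^ 2 ≤
        ((Row5002C.betaB : ℚ) : ℝ) ^ 2 * ∑ j ∈ (cubeIdx 28).biUnion nbrIdx \ cubeIdx 28, ‖w j‖ ^ 2)
    (hβCM : ∀ (c : ↥(cubeIdx 28) → ℂ) (g : ℂ),
      ∑ i ∈ ((cubeIdx 28).biUnion nbrIdx ∪ cubeIdx 112) \ cubeIdx 28,
        ‖-∑ j : ↥(cubeIdx 28), amc i j * (Binv (c, g)).1 j +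
          (Binv (c, g)).2 * vt i‖ ^ 2 ≤
        ((Row5002C.betaC : ℚ) : ℝ) ^ 2 * (∑ i : ↥(cubeIdx 28), ‖c i‖ ^ 2 + ‖g‖ ^ 2))
    (hgBM : ∀ w : Idx → ℂ,
      ‖(Binv (fun i : ↥(cubeIdx 28) => ∑ j ∈ nbrIdx i \ cubeIdx 28,
          amc i j * w j, 0)).2‖ ^ 2 ≤
        (((2198037866660847 : ℚ) / 562949953421312 : ℚ) : ℝ) ^ 2 *
          ∑ j ∈ (cubeIdx 28).biUnion nbrIdx \ cubeIdx 28, ‖w j‖ ^ 2)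
    (hshellM : ∀ w : Idx → ℂ, (∀ i ∈ cubeIdx 28, w i = 0) →
      (((628200374963231 : ℚ) / 1125899906842624 : ℚ) : ℝ) * ∑ i ∈ cubeIdx (28 + 1) \ cubeIdx 28, ‖w i‖ ^ 2 ≤
        ∑ i ∈ cubeIdx (28 + 1) \ cubeIdx 28,
          ((((Row5002C.lamRe : ℚ) : ℝ) : ℂ).re - (-(onormSq i.1 / 500)) - Real.sqrt 2) * ‖w i‖ ^ 2 -
        RCLike.re (∑ i ∈ (cubeIdx 28).biUnion nbrIdx \ cubeIdx 28,
          conj (∑ j : ↥(cubeIdx 28), amc i j *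
            (Binv (fun i : ↥(cubeIdx 28) => ∑ j ∈ nbrIdx i \ cubeIdx 28,
              amc i j * w j, 0)).1 j) * w i))
    {HL HH HB : Finset Idx}
    (hHL : ∀ i : Idx, i ∈ HL ↔ onormSq i.1 ≤ (36 : ℝ) ^ 2)
    (hHH : ∀ i : Idx, i ∈ HH ↔ onormSq i.1 ≤ (37 : ℝ) ^ 2)
    (hHB : ∀ i : Idx, i ∈ HB ↔ (37 : ℝ) ^ 2 < onormSq i.1 ∧ onormSq i.1 ≤ ((37 : ℝ) + 1) ^ 2)
    (GH' Ah' : Matrix ↥HH ↥HH ℝ) (AHB' : Matrix ↥HH ↥HB ℝ) (ABH' : Matrix ↥HB ↥HH ℝ) (E : ↥HB → ℝ)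
    (V' : Matrix ↥HH (Fin 1) ℝ) (hGH' : GH'ᵀ = GH')
    (hAh' : Ah' = Matrix.of fun i j : ↥HH =>
      (if i = j then -(onormSq i.1.1 / (500 : ℝ)) - (6 / 25 : ℝ) else 0) + am i.1 j.1)
    (hAHB' : AHB' = Matrix.of fun (i : ↥HH) (l : ↥HB) => am i.1 l.1)
    (hABH' : ABH' = Matrix.of fun (l : ↥HB) (i : ↥HH) => am l.1 i.1)
    (hE : E = fun l : ↥HB => onormSq l.1.1 / (500 : ℝ) + (6 / 25 : ℝ) - Real.sqrt 2)
    (hR1' : ∀ x : ↥HH → ℝ, x ≠ 0 →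
      x ⬝ᵥ ((GH' * Ah' + Ah'ᵀ * GH' + (1 / 2 : ℝ) • ((GH' * AHB' + ABH'ᵀ) * Matrix.diagonal (fun l => (E l)⁻¹) *
        (GH' * AHB' + ABH'ᵀ)ᵀ)) *ᵥ x) < 0)
    (hR2' : ∀ x : ↥HH → ℝ, 0 ≤ x ⬝ᵥ ((GH' + V' * V'ᵀ) *ᵥ x))
    (vtI : AbcClassI.Idx → ℂ) (hvt0I : ∀ i, i ∉ AbcClassI.cubeIdx 112 → vtI i = 0)
    (hresI : ∑ i ∈ AbcClassI.cubeIdx 112 ∪ (AbcClassI.cubeIdx 112).biUnion AbcClassI.nbrIdx,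
      ‖(if i ∈ AbcClassI.cubeIdx 112 then (((((Row5001C.lamRe : ℚ) : ℝ) : ℂ) + (((Row5001C.lamIm : ℚ) : ℝ) : ℂ) * Complex.I) - ((-(onormSq i.1 / 500) : ℝ) : ℂ)) * vtI i
          else 0) - ∑ j ∈ AbcClassI.cubeIdx 112, amcI i j * vtI j‖ ^ 2 ≤ ((Row5001C.rnorm : ℚ) : ℝ) ^ 2)
    (hntbI : ∑ i ∈ AbcClassI.cubeIdx 112 \ AbcClassI.cubeIdx 28, ‖vtI i‖ ^ 2 ≤
      (((8161754834082577 : ℚ) / 1152921504606846976 : ℚ) : ℝ) ^ 2)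
    (BinvI : ((↥(AbcClassI.cubeIdx 28) → ℂ) × ℂ) →ₗ[ℂ] ((↥(AbcClassI.cubeIdx 28) → ℂ) × ℂ))
    (hBinvI : ∀ (c : ↥(AbcClassI.cubeIdx 28) → ℂ) (m : ℂ),
      BinvI (fun i : ↥(AbcClassI.cubeIdx 28) =>
          (((((Row5001C.lamRe : ℚ) : ℝ) : ℂ) + (((Row5001C.lamIm : ℚ) : ℝ) : ℂ) * Complex.I) - ((-(onormSq i.1.1 / 500) : ℝ) : ℂ)) * c i -
          ∑ j : ↥(AbcClassI.cubeIdx 28), amcI i j * c j + m * vtI i,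
        ∑ i : ↥(AbcClassI.cubeIdx 28), conj (vtI i) * c i) = (c, m))
    (hαMI : ∀ (c : ↥(AbcClassI.cubeIdx 28) → ℂ) (g : ℂ),
      ∑ j : ↥(AbcClassI.cubeIdx 28), ‖(BinvI (c, g)).1 j‖ ^ 2 + ‖(BinvI (c, g)).2‖ ^ 2 ≤
        ((Row5001C.alpha0 : ℚ) : ℝ) ^ 2 * (∑ i : ↥(AbcClassI.cubeIdx 28), ‖c i‖ ^ 2 + ‖g‖ ^ 2))
    (hβBMI : ∀ w : AbcClassI.Idx → ℂ,
      ∑ j : ↥(AbcClassI.cubeIdx 28), ‖(BinvI (fun i : ↥(AbcClassI.cubeIdx 28) => -∑ j ∈ AbcClassI.nbrIdx i \ AbcClassI.cubeIdx 28,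
          amcI i j * w j, 0)).1 j‖ ^ 2 +
        ‖(BinvI (fun i : ↥(AbcClassI.cubeIdx 28) => -∑ j ∈ AbcClassI.nbrIdx i \ AbcClassI.cubeIdx 28,
          amcI i j * w j, 0)).2‖ ^ 2 ≤
        ((Row5001C.betaB : ℚ) : ℝ) ^ 2 * ∑ j ∈ (AbcClassI.cubeIdx 28).biUnion AbcClassI.nbrIdx \ AbcClassI.cubeIdx 28, ‖w j‖ ^ 2)
    (hβCMI : ∀ (c : ↥(AbcClassI.cubeIdx 28) → ℂ) (g : ℂ),
      ∑ i ∈ ((AbcClassI.cubeIdx 28).biUnion AbcClassI.nbrIdx ∪ AbcClassI.cubeIdx 112) \ AbcClassI.cubeIdx 28,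
        ‖-∑ j : ↥(AbcClassI.cubeIdx 28), amcI i j * (BinvI (c, g)).1 j +
          (BinvI (c, g)).2 * vtI i‖ ^ 2 ≤
        ((Row5001C.betaC : ℚ) : ℝ) ^ 2 * (∑ i : ↥(AbcClassI.cubeIdx 28), ‖c i‖ ^ 2 + ‖g‖ ^ 2))
    (hgBMI : ∀ w : AbcClassI.Idx → ℂ,
      ‖(BinvI (fun i : ↥(AbcClassI.cubeIdx 28) => ∑ j ∈ AbcClassI.nbrIdx i \ AbcClassI.cubeIdx 28,
          amcI i j * w j, 0)).2‖ ^ 2 ≤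
        (((3449790300190025 : ℚ) / 2251799813685248 : ℚ) : ℝ) ^ 2 *
          ∑ j ∈ (AbcClassI.cubeIdx 28).biUnion AbcClassI.nbrIdx \ AbcClassI.cubeIdx 28, ‖w j‖ ^ 2)
    (hshellMI : ∀ w : AbcClassI.Idx → ℂ, (∀ i ∈ AbcClassI.cubeIdx 28, w i = 0) →
      (((4982293683959657 : ℚ) / 9007199254740992 : ℚ) : ℝ) * ∑ i ∈ AbcClassI.cubeIdx (28 + 1) \ AbcClassI.cubeIdx 28, ‖w i‖ ^ 2 ≤
        ∑ i ∈ AbcClassI.cubeIdx (28 + 1) \ AbcClassI.cubeIdx 28,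
          (((((Row5001C.lamRe : ℚ) : ℝ) : ℂ) + (((Row5001C.lamIm : ℚ) : ℝ) : ℂ) * Complex.I).re - (-(onormSq i.1 / 500)) - Real.sqrt 2) * ‖w i‖ ^ 2 -
        RCLike.re (∑ i ∈ (AbcClassI.cubeIdx 28).biUnion AbcClassI.nbrIdx \ AbcClassI.cubeIdx 28,
          conj (∑ j : ↥(AbcClassI.cubeIdx 28), amcI i j *
            (BinvI (fun i : ↥(AbcClassI.cubeIdx 28) => ∑ j ∈ AbcClassI.nbrIdx i \ AbcClassI.cubeIdx 28,
              amcI i j * w j, 0)).1 j) * w i))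
    {HLI HHI HBI : Finset AbcClassI.Idx}
    (hHLI : ∀ i : AbcClassI.Idx, i ∈ HLI ↔ onormSq i.1 ≤ (36 : ℝ) ^ 2)
    (hHHI : ∀ i : AbcClassI.Idx, i ∈ HHI ↔ onormSq i.1 ≤ (37 : ℝ) ^ 2)
    (hHBI : ∀ i : AbcClassI.Idx, i ∈ HBI ↔ (37 : ℝ) ^ 2 < onormSq i.1 ∧ onormSq i.1 ≤ ((37 : ℝ) + 1) ^ 2)
    (GHI AhI : Matrix ↥HHI ↥HHI ℝ) (AHBI : Matrix ↥HHI ↥HBI ℝ) (ABHI : Matrix ↥HBI ↥HHI ℝ) (EI : ↥HBI → ℝ)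
    (VI : Matrix ↥HHI (Fin 2) ℝ) (hGHI : GHIᵀ = GHI)
    (hAhI : AhI = Matrix.of fun i j : ↥HHI =>
      (if i = j then -(onormSq i.1.1 / (500 : ℝ)) - (1 / 4 : ℝ) else 0) + AbcClassI.amat i.1 j.1)
    (hAHBI : AHBI = Matrix.of fun (i : ↥HHI) (l : ↥HBI) => AbcClassI.amat i.1 l.1)
    (hABHI : ABHI = Matrix.of fun (l : ↥HBI) (i : ↥HHI) => AbcClassI.amat l.1 i.1)
    (hEI : EI = fun l : ↥HBI => onormSq l.1.1 / (500 : ℝ) + (1 / 4 : ℝ) - Real.sqrt 2)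
    (hR1I : ∀ x : ↥HHI → ℝ, x ≠ 0 →
      x ⬝ᵥ ((GHI * AhI + AhIᵀ * GHI + (1 / 2 : ℝ) • ((GHI * AHBI + ABHIᵀ) * Matrix.diagonal (fun l => (EI l)⁻¹) *
        (GHI * AHBI + ABHIᵀ)ᵀ)) *ᵥ x) < 0)
    (hR2I : ∀ x : ↥HHI → ℝ, 0 ≤ x ⬝ᵥ ((GHI + VI * VIᵀ) *ᵥ x)) :
    ∃ lamII lamI : ℂ,
      ‖lamII - (((Row5002C.lamRe : ℚ) : ℝ) : ℂ)‖ ≤ ((Row5002C.rho : ℚ) : ℝ) ∧ lamII.im = 0 ∧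
      ‖lamI - ((((Row5001C.lamRe : ℚ) : ℝ) : ℂ) + (((Row5001C.lamIm : ℚ) : ℝ) : ℂ) * Complex.I)‖ ≤
        ((Row5001C.rho : ℚ) : ℝ) ∧ 0 < lamI.im ∧ lamI.re < lamII.re ∧
      (∃ u : UnitAddTorus (Fin 3) → EuclideanSpace ℂ (Fin 3),
        Torus.LinNSResolventRel (1 / (2 * Real.pi * 500)) (Torus.abcFlow 1 1 1) (2 * Real.pi * lamII) u 0 ∧
          u ≠ 0 ∧ IsClassII (mFourierCoeff u)) ∧
      (∃ u : UnitAddTorus (Fin 3) → EuclideanSpace ℂ (Fin 3),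
        Torus.LinNSResolventRel (1 / (2 * Real.pi * 500)) (Torus.abcFlow 1 1 1) (2 * Real.pi * lamI) u 0 ∧
          u ≠ 0 ∧ IsClassI (mFourierCoeff u)) ∧
      (∃ u : UnitAddTorus (Fin 3) → EuclideanSpace ℂ (Fin 3),
        Torus.LinNSResolventRel (1 / (2 * Real.pi * 500)) (Torus.abcFlow 1 1 1) (2 * Real.pi * conj lamI) u 0 ∧
          u ≠ 0 ∧ IsClassI (mFourierCoeff u)) ∧
      (∀ (z : ℂ) (u : UnitAddTorus (Fin 3) → EuclideanSpace ℂ (Fin 3)),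
        Torus.LinNSResolventRel (1 / (2 * Real.pi * 500)) (Torus.abcFlow 1 1 1) (2 * Real.pi * z) u 0 → u ≠ 0 →
          IsClassII (mFourierCoeff u) → (6 / 25 : ℝ) ≤ z.re → z = lamII) ∧
      (∀ (z : ℂ) (u : UnitAddTorus (Fin 3) → EuclideanSpace ℂ (Fin 3)),
        Torus.LinNSResolventRel (1 / (2 * Real.pi * 500)) (Torus.abcFlow 1 1 1) (2 * Real.pi * z) u 0 → u ≠ 0 →
          IsClassI (mFourierCoeff u) → (1 / 4 : ℝ) ≤ z.re → z = lamI ∨ z = conj lamI) ∧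
      ∀ (z : ℂ) (u : UnitAddTorus (Fin 3) → EuclideanSpace ℂ (Fin 3)),
        Torus.LinNSResolventRel (1 / (2 * Real.pi * 500)) (Torus.abcFlow 1 1 1) (2 * Real.pi * z) u 0 → u ≠ 0 →
          IsClassI (mFourierCoeff u) → z.re < lamII.re := by
  obtain ⟨lamII, hcloseII, himII, hreloII, honeII, huniqII⟩ :=
    AbcInertia.R500II_exactly_one_tight_i4 wf hws hwt hwII hwon amc hamc e bf hbf am ham vt hvt0 hres hntb Binv hBinv
      hαM hβBM hβCM hgBM hshellM hHL hHH hHB GH' Ah' AHB' ABH' E V' hGH' hAh' hAHB' hABH' hE hR1' hR2'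
  obtain ⟨lamI, hcloseI, hreloI, himI, hpairI, hpaircI, huniqI⟩ :=
    AbcInertiaCI.R500I_exactly_pair_i4 wfI hwsI hwtI hwI hwonI amcI hamcI vtI hvt0I hresI hntbI BinvI hBinvI
      hαMI hβBMI hβCMI hgBMI hshellMI hHLI hHHI hHBI GHI AhI AHBI ABHI EI VI hGHI hAhI hAHBI hABHI hEI hR1I hR2I
  have hlt : (((((Row5001C.lamRe : ℚ) : ℝ) : ℂ) + (((Row5001C.lamIm : ℚ) : ℝ) : ℂ) * Complex.I)).re =
      ((Row5001C.lamRe : ℚ) : ℝ) := by simp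
  have hcon := lead_of_exactly_pair (ν := 1 / (2 * Real.pi * 500)) hlt row5001C_add_rho_lt_row5002C_sub_rho
    AbcInertiaCI.a_le_row5001C lamI hcloseI huniqI lamII hreloII
  obtain ⟨uI, huI, huI0, huIcl⟩ := hpairI
  exact ⟨lamII, lamI, hcloseII, himII, hcloseI, himI, hcon lamI uI huI huI0 huIcl, honeII, ⟨uI, huI, huI0, huIcl⟩,
    hpaircI, huniqII, huniqI, hcon⟩

end Rows

end Summit.NavierStokesRegularity.FluidComputer.AbcContestI

end
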